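import Literature.NumberTheory.Sieve.AffineLatticeParametrisation
import Literature.NumberTheory.Sieve.ClusterComplexity
import HarnessLib

/-!
# The parametrising system of `{Ax = b}` has Cauchy–Schwarz complexity at most `s` (Green–Tao 2010, §4, derivation of Theorem 1.8) — module M1b of rung F-CS1-eq

Topic `Literature/NumberTheory/Sieve`. Source: B. Green, T. Tao, *Linear equations in primes*,
Ann. of Math. 171 (2010), §4 (arXiv:math/0606088 p. 11): "The full rank of `A` ensures that the
codimension of `Ψ(ℤ^d)` is the minimal value, namely `s`. … If two of the `ψᵢ` were affinely
dependent then two of the coordinates of lattice points in `Γ` would obey an affine-linear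
constraint. This is equivalent to the row space of `A` containing a non-trivial vector with at
most two non-zero entries, which is contrary to assumption. From Lemma 1.6 we conclude that `Ψ`
has complexity at most `s`."

For the system `Ψ = paramSystem A x₀` of `AffineLatticeParametrisation.lean` this file proves:

* `genMat`, `rank_genMat`, `linearRank_paramSystem`: `dim Ψ̇ = kerDim A` (`= t − s` under full row
  rank) — row rank equals column rank of the generator matrix;
* `exists_vecMul_eq_of_kerOrth`: `(ker A_ℚ)^⊥` is the row space of `A` over `ℚ` (dimension count);
* `RowSpaceNondegenerate A` — Green–Tao's hypothesis of Thm. 1.8 verbatim ("the only element of the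
  row-space of `A` over `ℚ` with two or fewer non-zero entries is the zero vector") — and its
  kernel form `KerOrthNondegenerate A`, with `kerOrthNondegenerate_iff_rowSpaceNondegenerate`;
* `isFiniteComplexitySystem_paramSystem`, `coeff_paramSystem_ne_zero`: no two coordinate forms of
  `Ψ` are affinely dependent and none is constant;
* **`complexity_paramSystem_le`**: `complexity Ψ ≤ s`, via the Lemma 1.6 cover
  `hasIComplexityLE_sub_linearRank` (ClusterComplexity.lean).

## References

* [GreenTao2010] B. Green, T. Tao, *Linear equations in primes*, Ann. of Math. (2) 171 (2010),
  §4 (derivation of Thm. 1.8), Lemma 1.6, Def. 1.5, Thm. 1.8.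
-/

noncomputable section

open Finset Module
open scoped Matrix

namespace Literature.NumberTheory.Sieve

variable {s t : ℕ}

/-! ### The generator matrix and `dim Ψ̇` -/

/-- The `t × (kerDim A)` rational matrix whose columns are the kernel generators `v₁, …, v_n`
(equivalently: whose rows are the coefficient vectors `ψ̇ᵢ` of the parametrising system).
[cite: GreenTao2010, §4 (derivation of Thm. 1.8)] -/
def genMat (A : Matrix (Fin s) (Fin t) ℤ) : Matrix (Fin t) (Fin (kerDim A)) ℚ :=
  fun i k => (kerGen A k i : ℚ)

/-- [cite: GreenTao2010, §4 (derivation of Thm. 1.8)] -/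
@[simp] theorem genMat_apply (A : Matrix (Fin s) (Fin t) ℤ) (i : Fin t) (k : Fin (kerDim A)) :
    genMat A i k = (kerGen A k i : ℚ) := rfl

/-- [cite: GreenTao2010, §4 (derivation of Thm. 1.8)] -/
theorem transpose_genMat_mulVec (A : Matrix (Fin s) (Fin t) ℤ) (w : Fin t → ℚ)
    (k : Fin (kerDim A)) : ((genMat A)ᵀ *ᵥ w) k = castVec (kerGen A k) ⬝ᵥ w := rfl

/-- The generator matrix has rank `kerDim A` (its columns are `ℚ`-independent).
[cite: GreenTao2010, §4 (derivation of Thm. 1.8)] -/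
theorem rank_genMat (A : Matrix (Fin s) (Fin t) ℤ) : (genMat A).rank = kerDim A := by
  rw [Matrix.rank_eq_finrank_span_cols,
    show Set.range (genMat A).col = Set.range (fun k => castVec (kerGen A k)) from rfl,
    finrank_span_eq_card (linearIndependent_castVec_kerGen A), Fintype.card_fin]

/-- **The linear rank of the parametrising system is the rank of the kernel lattice**
("the codimension of `Ψ(ℤ^d)` is the minimal value, namely `s`").
[cite: GreenTao2010, §4 (derivation of Thm. 1.8) and Lemma 1.6] -/
theorem linearRank_paramSystem (A : Matrix (Fin s) (Fin t) ℤ) (x₀ : Fin t → ℤ) :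
    linearRank (paramSystem A x₀) = kerDim A := by
  unfold linearRank
  rw [show (Set.range fun j : Fin t => fun k => ((paramSystem A x₀ j).coeff k : ℚ)) =
      Set.range (genMat A).row from rfl, ← Matrix.rank_eq_finrank_span_row, rank_genMat]

/-- Under full row rank, `dim Ψ̇ = t − s`. [cite: GreenTao2010, §4 (derivation of Thm. 1.8)] -/
theorem linearRank_paramSystem_of_rank_eq {A : Matrix (Fin s) (Fin t) ℤ}
    (hA : (ratMat A).rank = s) (x₀ : Fin t → ℤ) : linearRank (paramSystem A x₀) = t - s := by
  rw [linearRank_paramSystem, kerDim_eq_of_rank_eq hA]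

/-! ### `(ker A_ℚ)^⊥` is the row space -/

/-- [cite: GreenTao2010, §4 (derivation of Thm. 1.8)] -/
theorem castVec_dotProduct_castVec (u x : Fin t → ℤ) :
    castVec u ⬝ᵥ castVec x = ((u ⬝ᵥ x : ℤ) : ℚ) := by
  simp [dotProduct, castVec_apply]

/-- Rational combinations of the rows of `A` are orthogonal to the kernel generators.
[cite: GreenTao2010, §4 (derivation of Thm. 1.8)] -/
theorem castVec_kerGen_dotProduct_vecMul (A : Matrix (Fin s) (Fin t) ℤ) (y : Fin s → ℚ)
    (k : Fin (kerDim A)) : castVec (kerGen A k) ⬝ᵥ (y ᵥ* ratMat A) = 0 := by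
  rw [dotProduct_comm, ← Matrix.dotProduct_mulVec, ratMat_mulVec_castVec, mulVec_kerGen,
    castVec_zero, dotProduct_zero]

/-- **`(ker A_ℚ)^⊥ = ` row space of `A` over `ℚ`**: a rational vector orthogonal to the kernel
generators is a rational combination of the rows of `A` (both spaces have dimension `rank A`).
[cite: GreenTao2010, §4 (derivation of Thm. 1.8)] -/
theorem exists_vecMul_eq_of_kerOrth {A : Matrix (Fin s) (Fin t) ℤ} {w : Fin t → ℚ}
    (hw : ∀ k, castVec (kerGen A k) ⬝ᵥ w = 0) : ∃ y : Fin s → ℚ, y ᵥ* ratMat A = w := by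
  have hUW : LinearMap.range (ratMat A).vecMulLinear ≤ LinearMap.ker (genMat A)ᵀ.mulVecLin := by
    rintro _ ⟨y, rfl⟩
    rw [LinearMap.mem_ker, Matrix.mulVecLin_apply]
    funext k
    rw [transpose_genMat_mulVec, Pi.zero_apply, Matrix.vecMulLinear_apply,
      castVec_kerGen_dotProduct_vecMul]
  have hU : finrank ℚ (LinearMap.range (ratMat A).vecMulLinear) = (ratMat A).rank := by
    rw [range_vecMulLinear, ← Matrix.rank_eq_finrank_span_row]
  have hW : finrank ℚ (LinearMap.ker (genMat A)ᵀ.mulVecLin) = (ratMat A).rank := by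
    have h1 := LinearMap.finrank_range_add_finrank_ker (genMat A)ᵀ.mulVecLin
    rw [Module.finrank_fin_fun] at h1
    have h2 : finrank ℚ (LinearMap.range (genMat A)ᵀ.mulVecLin) = kerDim A := by
      change (genMat A)ᵀ.rank = _
      rw [Matrix.rank_transpose, rank_genMat]
    have h3 := kerDim_eq_sub_rank A
    have h4 := Matrix.rank_le_width (ratMat A)
    omega
  have hEq := Submodule.eq_of_le_of_finrank_eq hUW (hU.trans hW.symm)
  have hwW : w ∈ LinearMap.ker (genMat A)ᵀ.mulVecLin := by
    rw [LinearMap.mem_ker, Matrix.mulVecLin_apply]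
    funext k
    exact hw k
  rw [← hEq] at hwW
  obtain ⟨y, hy⟩ := LinearMap.mem_range.mp hwW
  exact ⟨y, hy⟩

/-! ### Green–Tao's non-degeneracy hypothesis -/

/-- **Non-degeneracy of `A` (Thm. 1.8), verbatim**: "the only element of the row-space of `A`
over `ℚ` with two or fewer non-zero entries is the zero vector" — a rational combination of the
rows supported on at most two coordinates `{i, j}` vanishes. [cite: GreenTao2010, Thm. 1.8] -/
def RowSpaceNondegenerate (A : Matrix (Fin s) (Fin t) ℤ) : Prop :=
  ∀ y : Fin s → ℚ, ∀ i j : Fin t,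
    (∀ l, l ≠ i → l ≠ j → (y ᵥ* ratMat A) l = 0) → y ᵥ* ratMat A = 0

/-- **Non-degeneracy, kernel form**: every integer vector supported on at most two coordinates
which is orthogonal to the kernel lattice `Λ₀(A)` vanishes (equivalent to `RowSpaceNondegenerate`,
see `kerOrthNondegenerate_iff_rowSpaceNondegenerate`). [cite: GreenTao2010, Thm. 1.8 and §4] -/
def KerOrthNondegenerate (A : Matrix (Fin s) (Fin t) ℤ) : Prop :=
  ∀ u : Fin t → ℤ, (∀ x ∈ kerLattice A, u ⬝ᵥ x = 0) →
    ∀ i j : Fin t, (∀ l, l ≠ i → l ≠ j → u l = 0) → u = 0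

/-- An integer vector which is a rational combination of the rows of `A` is orthogonal to the
kernel lattice. [cite: GreenTao2010, Thm. 1.8 and §4] -/
theorem kerOrth_of_mem_rowSpace {A : Matrix (Fin s) (Fin t) ℤ} {u : Fin t → ℤ} {y : Fin s → ℚ}
    (hu : castVec u = y ᵥ* ratMat A) : ∀ x ∈ kerLattice A, u ⬝ᵥ x = 0 := by
  intro x hx
  have hq : castVec u ⬝ᵥ castVec x = 0 := by
    rw [hu, ← Matrix.dotProduct_mulVec, ratMat_mulVec_castVec, mem_kerLattice.mp hx, castVec_zero,
      dotProduct_zero]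
  rw [castVec_dotProduct_castVec] at hq
  exact_mod_cast hq

/-- Orthogonality to the generators is orthogonality to the lattice.
[cite: GreenTao2010, §4 (derivation of Thm. 1.8)] -/
theorem dotProduct_eq_zero_of_kerGen {A : Matrix (Fin s) (Fin t) ℤ} {u : Fin t → ℤ}
    (hu : ∀ k, u ⬝ᵥ kerGen A k = 0) {x : Fin t → ℤ} (hx : x ∈ kerLattice A) : u ⬝ᵥ x = 0 := by
  obtain ⟨c, rfl⟩ := exists_sum_smul_kerGen_eq hx
  rw [dotProduct_sum]
  refine Finset.sum_eq_zero fun k _ => ?_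
  rw [dotProduct_smul, hu k, smul_zero]

/-- Row-space form ⇒ kernel form. [cite: GreenTao2010, Thm. 1.8 and §4] -/
theorem kerOrthNondegenerate_of_rowSpaceNondegenerate {A : Matrix (Fin s) (Fin t) ℤ}
    (h : RowSpaceNondegenerate A) : KerOrthNondegenerate A := by
  intro u hu i j hsupp
  have hw : ∀ k, castVec (kerGen A k) ⬝ᵥ castVec u = 0 := fun k => by
    rw [dotProduct_comm, castVec_dotProduct_castVec, hu _ (kerGen_mem A k), Int.cast_zero]
  obtain ⟨y, hy⟩ := exists_vecMul_eq_of_kerOrth hw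
  have h0 := h y i j (fun l hli hlj => by rw [hy, castVec_apply, hsupp l hli hlj, Int.cast_zero])
  rw [hy] at h0
  exact castVec_injective (h0.trans castVec_zero.symm)

/-- Kernel form ⇒ row-space form (clear denominators). [cite: GreenTao2010, Thm. 1.8 and §4] -/
theorem rowSpaceNondegenerate_of_kerOrthNondegenerate {A : Matrix (Fin s) (Fin t) ℤ}
    (h : KerOrthNondegenerate A) : RowSpaceNondegenerate A := by
  classical
  intro y i j hsupp
  set w : Fin t → ℚ := y ᵥ* ratMat A with hwdef
  -- a common denominator
  set D : ℤ := ∏ l, ((w l).den : ℤ) with hD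
  have hD0 : D ≠ 0 := Finset.prod_ne_zero_iff.mpr fun l _ => by exact_mod_cast (w l).den_nz
  have hdvd : ∀ l, ((w l).den : ℤ) ∣ D := fun l =>
    Finset.dvd_prod_of_mem (fun l => ((w l).den : ℤ)) (Finset.mem_univ l)
  set u : Fin t → ℤ := fun l => (w l).num * (D / (w l).den) with hudef
  have hu : ∀ l, (u l : ℚ) = (D : ℚ) * w l := fun l => by
    have hden : ((w l).den : ℚ) ≠ 0 := by exact_mod_cast (w l).den_nz
    rw [hudef]
    push_cast
    rw [Int.cast_div (hdvd l) (by exact_mod_cast (w l).den_nz)]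
    push_cast
    conv_rhs => rw [← Rat.num_div_den (w l)]
    field_simp
  have hcu : castVec u = ((D : ℚ) • y) ᵥ* ratMat A := by
    funext l
    rw [castVec_apply, hu l, Matrix.smul_vecMul, Pi.smul_apply, smul_eq_mul]
  have hz := h u (kerOrth_of_mem_rowSpace hcu) i j (fun l hli hlj => by
    have := hu l
    rw [hsupp l hli hlj, mul_zero] at this
    exact_mod_cast this)
  funext l
  have hl := hu l
  rw [hz, Pi.zero_apply, Int.cast_zero] at hl
  have : (D : ℚ) ≠ 0 := by exact_mod_cast hD0
  rw [Pi.zero_apply]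
  exact (mul_eq_zero.mp hl.symm).resolve_left this

/-- **The two forms of Green–Tao's non-degeneracy hypothesis agree.**
[cite: GreenTao2010, Thm. 1.8 and §4] -/
theorem kerOrthNondegenerate_iff_rowSpaceNondegenerate (A : Matrix (Fin s) (Fin t) ℤ) :
    KerOrthNondegenerate A ↔ RowSpaceNondegenerate A :=
  ⟨rowSpaceNondegenerate_of_kerOrthNondegenerate, kerOrthNondegenerate_of_rowSpaceNondegenerate⟩

/-! ### Finite complexity of the parametrising system -/

/-- **No coordinate form of `Ψ` is constant** (`ψ̇ᵢ ≠ 0`): else `eᵢ` would be a row-space vector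
with one non-zero entry. [cite: GreenTao2010, §4 (derivation of Thm. 1.8)] -/
theorem coeff_paramSystem_ne_zero {A : Matrix (Fin s) (Fin t) ℤ} (h : KerOrthNondegenerate A)
    (x₀ : Fin t → ℤ) (i : Fin t) : (paramSystem A x₀ i).coeff ≠ 0 := by
  classical
  intro h0
  have hk : ∀ k, kerGen A k i = 0 := fun k => by
    have := congr_fun h0 k
    simpa using this
  have horth : ∀ x ∈ kerLattice A, (Pi.single i (1 : ℤ)) ⬝ᵥ x = 0 :=
    fun x hx => dotProduct_eq_zero_of_kerGen (fun k => by rw [single_dotProduct, hk k, mul_zero]) hx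
  have hz := h _ horth i i (fun l hl _ => by simp [hl])
  have := congr_fun hz i
  simp at this

/-- **No two coordinate forms of `Ψ` are affinely dependent** (the system has finite complexity):
a dependency `a ψ̇ᵢ = b ψ̇ⱼ` makes `a eᵢ − b eⱼ` a row-space vector with at most two non-zero
entries. [cite: GreenTao2010, §4 (derivation of Thm. 1.8)] -/
theorem isFiniteComplexitySystem_paramSystem {A : Matrix (Fin s) (Fin t) ℤ}
    (h : KerOrthNondegenerate A) (x₀ : Fin t → ℤ) :
    IsFiniteComplexitySystem (paramSystem A x₀) := by
  classical
  intro i j hij a b hab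
  have hk : ∀ k, a * kerGen A k i = b * kerGen A k j := fun k => by
    have := congr_fun hab k
    simpa using this
  set u : Fin t → ℤ := Pi.single i a - Pi.single j b with hu
  have horth : ∀ x ∈ kerLattice A, u ⬝ᵥ x = 0 := fun x hx =>
    dotProduct_eq_zero_of_kerGen (fun k => by
      rw [hu, sub_dotProduct, single_dotProduct, single_dotProduct, hk k, sub_self]) hx
  have hz := h u horth i j (fun l hli hlj => by simp [hu, hli, hlj])
  have hi := congr_fun hz i
  have hj := congr_fun hz j
  simp only [hu, Pi.sub_apply, Pi.single_eq_same, Pi.single_eq_of_ne hij,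
    Pi.single_eq_of_ne (Ne.symm hij), Pi.zero_apply, sub_zero, zero_sub, neg_eq_zero] at hi hj
  exact ⟨hi, hj⟩

/-! ### Complexity at most `s` -/

/-- **The parametrising system has complexity `≤ s`** (Green–Tao: "From Lemma 1.6 we conclude
that `Ψ` has complexity at most `s`"): the Lemma 1.6 cover gives `i`-complexity
`≤ t − dim Ψ̇ = t − (t − s) = s`. [cite: GreenTao2010, §4 (derivation of Thm. 1.8) and Lemma 1.6] -/
theorem complexity_paramSystem_le {A : Matrix (Fin s) (Fin t) ℤ} (hA : (ratMat A).rank = s)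
    (h : KerOrthNondegenerate A) (x₀ : Fin t → ℤ) : complexity (paramSystem A x₀) ≤ (s : ℕ) := by
  have hst : s ≤ t := by
    have := Matrix.rank_le_width (ratMat A)
    rwa [hA] at this
  refine complexity_le_coe_iff.mpr fun i => ?_
  have hc := hasIComplexityLE_sub_linearRank (isFiniteComplexitySystem_paramSystem h x₀)
    (coeff_paramSystem_ne_zero h x₀) i
  rwa [linearRank_paramSystem_of_rank_eq hA, show t - (t - s) = s by omega] at hc

/-- The same under Green–Tao's verbatim (row-space) hypothesis.
[cite: GreenTao2010, §4 (derivation of Thm. 1.8) and Thm. 1.8] -/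
theorem complexity_paramSystem_le_of_rowSpaceNondegenerate {A : Matrix (Fin s) (Fin t) ℤ}
    (hA : (ratMat A).rank = s) (h : RowSpaceNondegenerate A) (x₀ : Fin t → ℤ) :
    complexity (paramSystem A x₀) ≤ (s : ℕ) :=
  complexity_paramSystem_le hA (kerOrthNondegenerate_of_rowSpaceNondegenerate h) x₀

end Literature.NumberTheory.Sieve

end
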